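import Mathlib
import Summits.Ventures.PercRepro2.Defs
import Summits.Ventures.PercRepro2.Harris
import Summits.Ventures.PercRepro2.Graph
import Summits.Ventures.PercRepro2.Events
import Summits.Ventures.PercRepro2.PsiPinInduction
import Summits.Ventures.PercRepro2.PsiUniSure
import Summits.Ventures.PercRepro2.PsiUniExplored
import Summits.Ventures.PercRepro2.PsiTEdge
import Summits.Ventures.PercRepro2.R21PinInduction
import Summits.Ventures.PercRepro2.R21OEdgeSGraph
import Summits.Ventures.PercRepro2.R21OEdgeS

/-!
# The `D_y`-masses of the open world of an `s`-edge (PercRepro2, p2)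

For an unpinned edge `f = {x, s}` with `x` in the explored `o`-component, opening `f` merges the
clusters of `o` and `s`: `h = {o ∈ C_s}` becomes sure, so the `hᶜ`-masses of `D_y` vanish, `P(aᶜ S O_u)`
vanishes (`O_u` and `a` coincide), `P(aᶜ h Y_u)` becomes `P(aᶜ O_uᶜ Y_u)` and the two `h`-masses become
the `𝟙`-masses of the open world (`sEdge_transfer`).  Part of the `s`-edge case of (UNI-R⁺_o).
-/

namespace Summit.Ventures.PercRepro2

section SEdgePlusTransfer

variable {V : Type*} {E : Type*} [Fintype E] [DecidableEq E]
  {R : Type*} [CommRing R] [LinearOrder R]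

/-- The seven `D_y`-masses of the open world `p[f↦1]` of an `s`-edge as closed-world masses. -/
lemma sEdge_dy_transfer (p : E → R) (ends : E → Sym2 V) (s y o u x : V) (f : E)
    (hf : ends f = s(x, s)) (hx : Conn ends (fun e => decide (p e = 1)) o x) (hpf : p f ≠ 1) :
    prob (Function.update p f 1) ((connEvent ends s u)ᶜ ∩ connEvent ends s o ∩ connEvent ends y u) = prob (Function.update p f 0) ((connEvent ends s u)ᶜ ∩ (connEvent ends o u)ᶜ ∩ connEvent ends y u) ∧
      prob (Function.update p f 1) ((connEvent ends s u)ᶜ ∩ connEvent ends s y ∩ connEvent ends o u) = 0 ∧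
      prob (Function.update p f 1) ((connEvent ends s y)ᶜ ∩ (connEvent ends s o)ᶜ ∩ (connEvent ends y o)ᶜ) = 0 ∧
      prob (Function.update p f 1) (connEvent ends s o ∩ (connEvent ends s y)ᶜ) = prob (Function.update p f 0) (((connEvent ends s y)ᶜ ∩ (connEvent ends o y)ᶜ)) ∧
      prob (Function.update p f 1) ((connEvent ends s o)ᶜ ∩ connEvent ends s y ∩ connEvent ends s u) = 0 ∧
      prob (Function.update p f 1) (connEvent ends s u ∩ connEvent ends s o ∩ (connEvent ends s y)ᶜ) = prob (Function.update p f 0) ((connEvent ends s u ∪ connEvent ends o u) ∩ ((connEvent ends s y)ᶜ ∩ (connEvent ends o y)ᶜ)) ∧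
      prob (Function.update p f 1) ((connEvent ends s o)ᶜ ∩ connEvent ends s y) = 0 := by
  have key : ∀ (A A' : Set (Config E)),
      (∀ ω : Config E, (∀ e, e ≠ f → p e = 1 → ω e = true) →
        (Function.update ω f true ∈ A ↔ Function.update ω f false ∈ A')) →
      prob (Function.update p f 1) A = prob (Function.update p f 0) A' :=
    fun A A' h => prob_update_one_eq_prob_update_zero_of_respects p f fun ω _ h1 => h ω h1
  have hsv : ∀ (ω : Config E), (∀ e, e ≠ f → p e = 1 → ω e = true) → ∀ v,
      Conn ends (Function.update ω f true) s v ↔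
        Conn ends (Function.update ω f false) s v ∨ Conn ends (Function.update ω f false) o v :=
    fun ω h1 v => conn_update_true_s_iff_or_o hf hx hpf h1 v
  have hyu : ∀ (ω : Config E), (∀ e, e ≠ f → p e = 1 → ω e = true) →
      (Conn ends (Function.update ω f true) y u ↔
        Conn ends (Function.update ω f false) y u ∨
          (Conn ends (Function.update ω f false) y o ∧ Conn ends (Function.update ω f false) s u) ∨
          (Conn ends (Function.update ω f false) y s ∧ Conn ends (Function.update ω f false) o u)) := by
    intro ω h1
    rw [conn_update_true_iff_or hf, conn_x_iff_o hx hpf h1]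
    have hyx : Conn ends (Function.update ω f false) y x ↔ Conn ends (Function.update ω f false) y o :=
      ⟨fun h => conn_symm ((conn_x_iff_o hx hpf h1 y).1 (conn_symm h)),
       fun h => conn_symm ((conn_x_iff_o hx hpf h1 y).2 (conn_symm h))⟩
    rw [hyx]
  have hou : ∀ (ω : Config E), (∀ e, e ≠ f → p e = 1 → ω e = true) →
      (Conn ends (Function.update ω f true) o u ↔
        Conn ends (Function.update ω f false) o u ∨ Conn ends (Function.update ω f false) s u) := by
    intro ω h1
    rw [conn_update_true_iff_or hf, conn_x_iff_o hx hpf h1]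
    have hox : Conn ends (Function.update ω f false) o x :=
      conn_symm ((conn_x_iff_o hx hpf h1 o).2 (conn_refl _ _ _))
    constructor
    · rintro (h | ⟨_, h⟩ | ⟨_, h⟩)
      · exact Or.inl h
      · exact Or.inr h
      · exact Or.inl h
    · rintro (h | h)
      · exact Or.inl h
      · exact Or.inr (Or.inl ⟨hox, h⟩)
  have h0 : prob (Function.update p f 0) (∅ : Set (Config E)) = 0 := prob_empty _
  refine ⟨?_, ?_, ?_, ?_, ?_, ?_, ?_⟩
  · refine key _ _ fun ω h1 => ?_
    simp only [Set.mem_inter_iff, mem_connEvent, Set.mem_compl_iff, hsv ω h1, hyu ω h1, conn_refl,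
      or_true, not_or]
    tauto
  · refine (key _ ∅ fun ω h1 => ?_).trans h0
    simp only [Set.mem_inter_iff, mem_connEvent, Set.mem_compl_iff, hsv ω h1, hou ω h1,
      Set.mem_empty_iff_false, iff_false, not_or]
    tauto
  · refine (key _ ∅ fun ω h1 => ?_).trans h0
    simp only [Set.mem_inter_iff, mem_connEvent, Set.mem_compl_iff, hsv ω h1, conn_refl, or_true,
      Set.mem_empty_iff_false, iff_false, not_or]
    tauto
  · refine key _ _ fun ω h1 => ?_
    simp only [Set.mem_inter_iff, mem_connEvent, Set.mem_compl_iff, hsv ω h1, conn_refl, or_true,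
      true_and, not_or]
  · refine (key _ ∅ fun ω h1 => ?_).trans h0
    simp only [Set.mem_inter_iff, mem_connEvent, Set.mem_compl_iff, hsv ω h1, conn_refl, or_true,
      Set.mem_empty_iff_false, iff_false]
    tauto
  · refine key _ _ fun ω h1 => ?_
    simp only [Set.mem_inter_iff, mem_connEvent, Set.mem_compl_iff, Set.mem_union, hsv ω h1,
      conn_refl, or_true, and_true, not_or]
  · refine (key _ ∅ fun ω h1 => ?_).trans h0
    simp only [Set.mem_inter_iff, mem_connEvent, Set.mem_compl_iff, hsv ω h1, conn_refl, or_true,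
      Set.mem_empty_iff_false, iff_false]
    tauto

end SEdgePlusTransfer

end Summit.Ventures.PercRepro2
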